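import Summits.BirchSwinnertonDyer.BirchSwinnertonDyer.Theorems.CyclotomicUntwistF1OfLatticeGrowth
import HarnessLib

/-!
# F1 from a LATTICE, II: the untwisted `p`-adic `L`-function (D1) exists as soon as the explicit
# Mazur–Tate–Teitelbaum candidate, computed over a coefficient field `K`, is the complex shadow of an
# untwist symbol with values in a finitely generated `ℤ`-module (growth `½` without Manin–Drinfeld for `Γ₁`)

Cell `pub/bsd-wall` (D-0145 line `route-BirchSwinnertonDyer-CyclotomicUntwist`), seat `bsd-line-cycu-p3`
(prover seat 3/3, gen 9). THEOREMS ONLY (no definition, no named fact, no `sorry`); helper toward the crux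
child C1 = stmt-BirchSwinnertonDyer-27548 (`PSUntwistedLFunctionAtThree`), whose research residual after
`CyclotomicUntwistFiniteSlopeSeparatedPinnedLogNormPrint.hEX'_of_print` is F1′: «`∃ η α 𝓛`, `η` primitive,
`α² − a_w α + 3 = 0`, `IsPSCyclotomicLFunctionOf W η α 𝓛`». BSD is not proved by this file; no crux and no
child of the route is proved by it; K1/K2 stay OPEN and WHOLE. Second of two files (prequel
`CyclotomicUntwistF1OfLatticeGrowth`: the unstable recursion §1, growth from a bound §2, lattice ⟹ bounded §3).

WHAT.

* §4 `map_alpha_pow_mul_nu_eq_psi` — over a coefficient field `K` with embeddings `ι_p : K →+* ℂ_p` and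
  `ι_∞ : K →+* ℂ`: if `Ψ : ℚ → ℂ` is `ℤ`-periodic and satisfies the `p`-deprivation identity
  `Ψ(r) − (ι_∞α_K/p) Ψ(p r) = ∑_b ι_∞η_K(b)[r + b/p^c]⁺_f` (the identity (S3) of `PSUntwistExistence`, i.e.
  `{∞,r}_g − (α/p){∞,pr}_g = {∞,r}_{f⊗η̄}` for the untwist `g`, in the rational plus symbols of `f`), then
  `ι_∞(α_K^M ν^K_M(x)) = Ψ(x/p^M)` for the `K`-valued candidate — by INDUCTION on `M` along the unstable
  recursion (uniqueness needs no bound on the complex side, only `ι_∞ α_K ≠ p`); hence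
  `exists_fg_forall_alpha_pow_mul_nu_mem` — if the `Ψ(a/p^M)` lie in a finitely generated `ℤ`-submodule of
  `ℂ` (what MODULARITY of `g` on some `Γ₁(L)` gives by Manin's continued-fraction trick, with no
  Manin–Drinfeld theorem and no Shimura algebraicity), then the `α_K^M ν^K_M(x)` lie in a finitely
  generated `ℤ`-submodule of `K` (`ℤ` is Noetherian; `ι_∞` is injective).
* §5 MAIN `hasGrowthOrder_half_map_candidate_of_lattice` and `exists_isUntwistedPAdicLFunction_of_lattice`
  (any `p`, conductor `p^c`, `c ≥ 1`), §6 `exists_isPSCyclotomicLFunctionOf_of_lattice` (curve level,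
  `p = 3`, `c = 2`): F1 for `(η_K ∘ ι_p, ι_p α_K)` from a complex untwist symbol `Ψ` with lattice values —
  the `g`-free form of Mazur–Tate–Teitelbaum §I.14 in which the bounded-denominator input is replaced by
  its source, a finitely generated period module.

WHY (route bookkeeping). cycu-p4 g9 (HANDOFF § 14:45Z) priced «C1 ⟸ print» as needing a `Γ₁`-nebentypus
modular-symbol definition layer plus named facts {Atkin–Li, Carayol, NOS, Shimura 1977 / Manin–Drinfeld `Γ₁`}.
With this file the Shimura-1977 / Manin–Drinfeld-`Γ₁` inputs DISAPPEAR: the only modular input left is a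
weight-`2` cusp form `g` on some `Γ₁(L)` with `g − α g(p·) = κ·∑_u η(u) f(· + u/p^c)` (the `α`-stabilised
untwist), whose ray integrals are `ℤ`-periodic and generate a finitely generated `ℤ`-module (Manin 1972 §1.5,
elementary for ANY finite-index level) — sequel files of this seat supply those two facts and the assembly.

References: [cite: MazurTateTeitelbaum1986Invent, §I.10–§I.11 and §I.14 (case p ∣ N)] ·
[cite: Bellaiche2021, Def. 6.2.10, Thm. 6.2.13, Thm. 6.7.9] · [cite: Manin1972, §1.5, Prop. 1.6].
-/

noncomputable section

open scoped MatrixGroups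

open CongruenceSubgroup DirichletCharacter Literature.NumberTheory.EllipticCurves
  Literature.NumberTheory.EllipticCurves.ModularForms Literature.NumberTheory.IwasawaTheory
  Summit.BirchSwinnertonDyer.BirchSwinnertonDyer.Theorems.PSF1Reduction
  Summit.BirchSwinnertonDyer.BirchSwinnertonDyer.Theorems.PSCandidateUniqueness

-- single-conjunct summit: `Summit.BirchSwinnertonDyer.BirchSwinnertonDyer.…` repeats the name by design
set_option linter.dupNamespace false
set_option autoImplicit false

namespace Summit.BirchSwinnertonDyer.BirchSwinnertonDyer.Theorems.PSF1OfLattice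

variable {p : ℕ}

/-! ### §4 The complex side: an untwist symbol with the `p`-deprivation identity computes the `K`-candidate -/

section ComplexSidePrelim

variable {K : Type*} [Field K] (ι : K →+* ℂ)

include ι in
/-- A field with a ring homomorphism to `ℂ` has characteristic zero on `p`: `(p : K) ≠ 0` for `p ≠ 0`.
[folklore] -/
theorem natCast_ne_zero_of_ringHom (hp : p ≠ 0) : (p : K) ≠ 0 := fun h ↦ by
  have := congrArg ι h
  rw [map_natCast, map_zero] at this
  exact (Nat.cast_ne_zero.mpr hp) this

variable [Fact p.Prime] {N : ℕ} (f : CuspForm (Gamma0 N) 2)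
variable {c : ℕ} (ηK : DirichletCharacter K (p ^ c))
variable (SK : (j : ℕ) → ZMod (p ^ j) → K)
variable (hSK : ∀ (j : ℕ) (y : ZMod (p ^ j)), SK j y = ∑ b : ZMod (p ^ c), ηK b *
  ((ratPlusSymbol f ((y.val : ℚ) / (p : ℚ) ^ j + (b.val : ℚ) / (p : ℚ) ^ c) : ℚ) : K))

include hSK in
/-- `ι_∞` maps the `K`-valued twisted symbols to the complex ones (the plus symbols are rational). [folklore] -/
theorem map_SK (j : ℕ) (y : ZMod (p ^ j)) :
    ι (SK j y) = ∑ b : ZMod (p ^ c), ι (ηK b) *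
      ((ratPlusSymbol f ((y.val : ℚ) / (p : ℚ) ^ j + (b.val : ℚ) / (p : ℚ) ^ c) : ℚ) : ℂ) := by
  rw [hSK, map_sum]
  refine Finset.sum_congr rfl fun b _ ↦ ?_
  rw [map_mul, map_ratCast]

end ComplexSidePrelim

section ComplexSide

variable [Fact p.Prime] {K : Type*} [Field K] (ι : K →+* ℂ)
variable {N : ℕ} (f : CuspForm (Gamma0 N) 2)
variable {c : ℕ} (ηK : DirichletCharacter K (p ^ c)) (αK : K)
variable (SK : (j : ℕ) → ZMod (p ^ j) → K)
variable (hSK : ∀ (j : ℕ) (y : ZMod (p ^ j)), SK j y = ∑ b : ZMod (p ^ c), ηK b *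
  ((ratPlusSymbol f ((y.val : ℚ) / (p : ℚ) ^ j + (b.val : ℚ) / (p : ℚ) ^ c) : ℚ) : K))
variable (νK : (M : ℕ) → ZMod (p ^ M) → K)
variable (hνK : ∀ (M : ℕ) (x : ZMod (p ^ M)), νK M x =
  (∑ i ∈ Finset.range M, αK⁻¹ ^ (i + 1) * ((p : K) ^ (i + 1) / (p : K) ^ M) *
      SK (i + 1) ((x.val : ℕ) : ZMod (p ^ (i + 1)))) +
    ((p : K) ^ M)⁻¹ * (1 - αK / p)⁻¹ * SK 0 0)
variable (Ψ : ℚ → ℂ)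
variable (hΨper : ∀ (r : ℚ) (n : ℤ), Ψ (r + n) = Ψ r)
variable (hΨrec : ∀ r : ℚ, Ψ r - ι αK / p * Ψ (p * r) =
  ∑ b : ZMod (p ^ c), ι (ηK b) * ((ratPlusSymbol f (r + (b.val : ℚ) / (p : ℚ) ^ c) : ℚ) : ℂ))

include hΨrec in
/-- **Base of the induction**: the deprivation identity at `r = 0` reads `Ψ(0)(1 − α/p) = ι S₀`, so
`Ψ(0) = (1 − α/p)⁻¹ ι(S₀)` when `ι α_K ≠ p`. [cite: MazurTateTeitelbaum1986Invent, §I.10] -/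
theorem psi_zero (hSK0 : ι (SK 0 0) = ∑ b : ZMod (p ^ c), ι (ηK b) *
      ((ratPlusSymbol f ((0 : ℚ) + (b.val : ℚ) / (p : ℚ) ^ c) : ℚ) : ℂ))
    (hα : ι αK ≠ p) : Ψ 0 = (1 - ι αK / p)⁻¹ * ι (SK 0 0) := by
  have hp : p.Prime := Fact.out
  have hp0 : (p : ℂ) ≠ 0 := Nat.cast_ne_zero.mpr hp.ne_zero
  have h1 : (1 - ι αK / p : ℂ) ≠ 0 := by
    intro h
    apply hα
    rw [sub_eq_zero, eq_div_iff hp0, one_mul] at h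
    exact h.symm
  have h0 := hΨrec 0
  rw [mul_zero, ← hSK0] at h0
  rw [eq_inv_mul_iff_mul_eq₀ h1, ← h0]
  ring

include hSK hνK hΨper hΨrec in
/-- **UNIQUENESS ALONG THE UNSTABLE RECURSION: `ι_∞(α_K^M ν^K_M(x)) = Ψ(x/p^M)`.** Both sides satisfy
`X_{M+1}(x) = ι S_{M+1}(x) + (ι α_K/p) X_M(x mod p^M)` with the same start (`psi_zero`,
`alpha_pow_mul_nu_zero/succ`); for `Ψ` this is the deprivation identity at `r = x/p^{M+1}` plus
`ℤ`-periodicity (`x/p^M` and `(x mod p^M)/p^M` differ by an integer). No bound on `Ψ` is used.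
[cite: MazurTateTeitelbaum1986Invent, §I.10 and §I.14] -/
theorem map_alpha_pow_mul_nu_eq_psi (hαK : αK ≠ 0) (hα : ι αK ≠ p) (M : ℕ) (x : ZMod (p ^ M)) :
    ι (αK ^ M * νK M x) = Ψ ((x.val : ℚ) / (p : ℚ) ^ M) := by
  have hp : p.Prime := Fact.out
  have hpK : (p : K) ≠ 0 := natCast_ne_zero_of_ringHom ι hp.ne_zero
  induction M with
  | zero =>
    haveI : NeZero (p ^ 0) := ⟨by simp⟩
    have hx : x.val = 0 := Nat.lt_one_iff.mp (by simpa using ZMod.val_lt x)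
    have hSK0 : ι (SK 0 0) = ∑ b : ZMod (p ^ c), ι (ηK b) *
        ((ratPlusSymbol f ((0 : ℚ) + (b.val : ℚ) / (p : ℚ) ^ c) : ℚ) : ℂ) := by
      rw [map_SK ι f ηK SK hSK]
      simp
    rw [alpha_pow_mul_nu_zero αK SK νK hνK, map_mul, map_inv₀, map_sub, map_one, map_div₀, map_natCast, hx,
      Nat.cast_zero, zero_div, psi_zero ι f ηK αK SK Ψ hΨrec hSK0 hα]
  | succ M ih =>
    haveI : NeZero (p ^ (M + 1)) := ⟨pow_ne_zero _ hp.ne_zero⟩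
    haveI : NeZero (p ^ M) := ⟨pow_ne_zero _ hp.ne_zero⟩
    rw [alpha_pow_mul_nu_succ αK SK νK hνK hpK hαK M x, map_add, map_mul, map_div₀, map_natCast, ih]
    -- the deprivation identity at `r = x / p^{M+1}`
    have hrec := hΨrec ((x.val : ℚ) / (p : ℚ) ^ (M + 1))
    have hpM : ((p : ℚ) ^ M) ≠ 0 := pow_ne_zero _ (Nat.cast_ne_zero.mpr hp.ne_zero)
    rw [← map_SK ι f ηK SK hSK, show (p : ℚ) * ((x.val : ℚ) / (p : ℚ) ^ (M + 1)) = (x.val : ℚ) / (p : ℚ) ^ M by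
      rw [pow_succ (p : ℚ) M, mul_div_assoc', div_mul_eq_div_div, mul_div_assoc,
        mul_div_cancel_left₀ _ (Nat.cast_ne_zero.mpr hp.ne_zero)]] at hrec
    -- `x / p^M` and `(x mod p^M) / p^M` differ by the integer `x div p^M`
    have hper : Ψ ((((ZMod.castHom (pow_dvd_pow p M.le_succ) (ZMod (p ^ M)) x).val : ℕ) : ℚ) / (p : ℚ) ^ M) =
        Ψ ((x.val : ℚ) / (p : ℚ) ^ M) := by
      rw [ZMod.castHom_apply, ZMod.cast_eq_val, ZMod.val_natCast, ← hΨper _ ((x.val / p ^ M : ℕ) : ℤ)]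
      congr 1
      rw [Int.cast_natCast, div_add' _ _ _ hpM, div_left_inj' hpM]
      exact_mod_cast Nat.mod_add_div' x.val (p ^ M)
    rw [hper]
    linear_combination (-1 : ℂ) * hrec

variable {Λ : Submodule ℤ ℂ}

include hSK hνK hΨper hΨrec in
/-- **Lattice values descend to `K`.** If the symbol `Ψ` takes values in a finitely generated `ℤ`-submodule
`Λ ⊆ ℂ`, then the `α_K^M ν^K_M(x)` lie in a finitely generated `ℤ`-submodule of `K` — the preimage of
`Λ` under the (injective) embedding `ι_∞`, finitely generated because `ℤ` is Noetherian.
[cite: Manin1972, §1.5, Prop. 1.6] -/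
theorem exists_fg_forall_alpha_pow_mul_nu_mem (hαK : αK ≠ 0) (hα : ι αK ≠ p) (hΛ : Λ.FG)
    (hΨΛ : ∀ (M : ℕ) (a : ℕ), Ψ ((a : ℚ) / (p : ℚ) ^ M) ∈ Λ) :
    ∃ ΛK : Submodule ℤ K, ΛK.FG ∧ ∀ (M : ℕ) (x : ZMod (p ^ M)), αK ^ M * νK M x ∈ ΛK := by
  set ιℤ : K →ₗ[ℤ] ℂ := ι.toAddMonoidHom.toIntLinearMap with hιℤ
  refine ⟨Λ.comap ιℤ, ?_, fun M x ↦ ?_⟩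
  · haveI : Module.Finite ℤ Λ := Module.Finite.iff_fg.mpr hΛ
    haveI : IsNoetherian ℤ Λ := isNoetherian_of_isNoetherianRing_of_finite ℤ Λ
    set g : Λ.comap ιℤ →ₗ[ℤ] Λ :=
      LinearMap.codRestrict Λ (ιℤ.domRestrict (Λ.comap ιℤ)) (fun y ↦ y.2) with hg
    have hιapply : ∀ w : K, ιℤ w = ι w := fun w ↦ rfl
    have hginj : Function.Injective g := by
      intro y z hyz
      have h1 : ιℤ (y : K) = ιℤ (z : K) := by
        have := congrArg (fun w : Λ ↦ (w : ℂ)) hyz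
        simpa [hg] using this
      rw [hιapply, hιapply] at h1
      exact Subtype.ext (ι.injective h1)
    haveI : Module.Finite ℤ (Λ.comap ιℤ) := Module.Finite.of_injective g hginj
    exact Module.Finite.iff_fg.mp inferInstance
  · rw [Submodule.mem_comap]
    change ι (αK ^ M * νK M x) ∈ Λ
    rw [map_alpha_pow_mul_nu_eq_psi ι f ηK αK SK hSK νK hνK Ψ hΨper hΨrec hαK hα M x]
    exact hΨΛ M x.val

end ComplexSide

/-! ### §5 MAIN: F1 from a complex untwist symbol with lattice values -/

section Main

variable [Fact p.Prime] {K : Type*} [Field K] (ιp : K →+* ℂ_[p]) (ι : K →+* ℂ)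
variable {N : ℕ} (f : CuspForm (Gamma0 N) 2)
variable {c : ℕ} (ηK : DirichletCharacter K (p ^ c)) (αK : K)
variable (SK : (j : ℕ) → ZMod (p ^ j) → K)
variable (hSK : ∀ (j : ℕ) (y : ZMod (p ^ j)), SK j y = ∑ b : ZMod (p ^ c), ηK b *
  ((ratPlusSymbol f ((y.val : ℚ) / (p : ℚ) ^ j + (b.val : ℚ) / (p : ℚ) ^ c) : ℚ) : K))
variable (νK : (M : ℕ) → ZMod (p ^ M) → K)
variable (hνK : ∀ (M : ℕ) (x : ZMod (p ^ M)), νK M x =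
  (∑ i ∈ Finset.range M, αK⁻¹ ^ (i + 1) * ((p : K) ^ (i + 1) / (p : K) ^ M) *
      SK (i + 1) ((x.val : ℕ) : ZMod (p ^ (i + 1)))) +
    ((p : K) ^ M)⁻¹ * (1 - αK / p)⁻¹ * SK 0 0)
variable (ρK : (M : ℕ) → ZMod (p ^ M) → K)
variable (hρK : ∀ (M : ℕ) (y : ZMod (p ^ M)), ρK M y = ηK⁻¹ ((y.val : ℕ) : ZMod (p ^ c)) * νK M y)
variable (𝓛K : (n : ℕ) → ZMod (p ^ n) → K)
variable (h𝓛K : ∀ (n : ℕ) (s : ZMod (p ^ n)), 𝓛K n s =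
  ∑ᶠ T : rootsOfUnity (torsionOrder p) ℤ_[p],
    ∑ y ∈ Finset.univ.filter (fun y : ZMod (p ^ (c + cyclotomicExponent p + n)) ↦
      ZMod.castHom (pow_dvd_pow p (by omega : cyclotomicExponent p + n ≤ c + cyclotomicExponent p + n))
          (ZMod (p ^ (cyclotomicExponent p + n))) y =
        PadicInt.toZModPow (cyclotomicExponent p + n) ((T : ℤ_[p]ˣ) : ℤ_[p]) *
          (cyclotomicGenerator p : ZMod (p ^ (cyclotomicExponent p + n))) ^ s.val),
      ρK (c + cyclotomicExponent p + n) y)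
variable (Ψ : ℚ → ℂ)
variable (hΨper : ∀ (r : ℚ) (n : ℤ), Ψ (r + n) = Ψ r)
variable (hΨrec : ∀ r : ℚ, Ψ r - ι αK / p * Ψ (p * r) =
  ∑ b : ZMod (p ^ c), ι (ηK b) * ((ratPlusSymbol f (r + (b.val : ℚ) / (p : ℚ) ^ c) : ℚ) : ℂ))
variable {Λ : Submodule ℤ ℂ}

include hSK hνK hρK h𝓛K hΨper hΨrec in
/-- **GROWTH `½` OF THE CANDIDATE FROM A LATTICE.** Coefficient field `K` with `ι_p : K →+* ℂ_p`,
`ι_∞ : K →+* ℂ`; `α_K ≠ 0` with `‖(ι_p α_K)⁻¹‖ ≤ √p` (slope `≤ ½`) and `ι_∞ α_K ≠ p`; a complex untwist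
symbol `Ψ` (`ℤ`-periodic, `p`-deprivation identity for `(ι_∞ ∘ η_K, ι_∞ α_K)`) whose values at the points
`a/p^M` lie in a finitely generated `ℤ`-submodule of `ℂ`. Then the `ℂ_p`-image of the `K`-valued explicit
candidate has growth of order `½`: §4 puts the `α_K^M ν^K_M(x)` in a finitely generated `ℤ`-module, §3 bounds
their `ι_p`-images, §2 converts the bound. [cite: MazurTateTeitelbaum1986Invent, §I.10–§I.14]
[cite: Bellaiche2021, Thm. 6.7.9 (growth rate)] [cite: Manin1972, §1.5] -/
theorem hasGrowthOrder_half_map_candidate_of_lattice (hαK : αK ≠ 0)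
    (hαn : ‖(ιp αK)⁻¹‖ ≤ (p : ℝ) ^ (1 / 2 : ℝ)) (hα : ι αK ≠ p) (hΛ : Λ.FG)
    (hΨΛ : ∀ (M : ℕ) (a : ℕ), Ψ ((a : ℚ) / (p : ℚ) ^ M) ∈ Λ) :
    HasGrowthOrder p (1 / 2) (fun n s ↦ ιp (𝓛K n s)) := by
  obtain ⟨ΛK, hΛK, hmem⟩ := exists_fg_forall_alpha_pow_mul_nu_mem ι f ηK αK SK hSK νK hνK Ψ hΨper hΨrec
    hαK hα hΛ hΨΛ
  obtain ⟨C, -, hC⟩ := exists_norm_map_le_of_fg (p := p) ιp hΛK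
  have hα0 : ιp αK ≠ 0 := (map_ne_zero ιp).mpr hαK
  have hbd : ∀ (M : ℕ) (x : ZMod (p ^ M)), ‖(ιp αK) ^ M * ιp (νK M x)‖ ≤ C := fun M x ↦ by
    rw [← map_pow, ← map_mul]
    exact hC _ (hmem M x)
  exact hasGrowthOrder_half_candidate_of_norm_nu_le (ηK.ringHomComp ιp) (fun M x ↦ ιp (νK M x))
    (fun M y ↦ ιp (ρK M y)) (map_rho ιp ηK νK ρK hρK) (fun n s ↦ ιp (𝓛K n s)) (map_L ιp ρK 𝓛K h𝓛K)
    (norm_nu_le_of_norm_alpha_pow_mul_nu_le (ιp αK) (fun M x ↦ ιp (νK M x)) hα0 hαn hbd)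

include hΨper hΨrec in
/-- **F1 FROM A LATTICE (any `p`, conductor `p^c`, `c ≥ 1`).** For a cusp form `f` on `Γ₀(N)`, a
coefficient field `K` with embeddings `ι_p : K →+* ℂ_p`, `ι_∞ : K →+* ℂ`, a primitive `η_K` mod `p^c` and
`α_K ≠ 0` in `K` with `‖(ι_p α_K)⁻¹‖ ≤ √p`, `ι_p α_K ≠ p`, `ι_∞ α_K ≠ p`: if there is a `ℤ`-periodic `Ψ : ℚ → ℂ`
with `Ψ(r) − (ι_∞α_K/p)Ψ(pr) = ∑_b ι_∞η_K(b)[r + b/p^c]⁺_f` whose values at the `a/p^M` lie in a finitely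
generated `ℤ`-submodule of `ℂ`, then the untwisted `p`-adic `L`-function EXISTS:
`∃ μ, IsUntwistedPAdicLFunction p f (η_K ∘ ι_p) (ι_p α_K) μ` — Mazur–Tate–Teitelbaum §I.14 with the
bounded-denominator input replaced by a lattice. [cite: MazurTateTeitelbaum1986Invent, §I.14 (case p ∣ N)]
[cite: Bellaiche2021, Thm. 6.7.9] [cite: Manin1972, §1.5, Prop. 1.6] -/
theorem exists_isUntwistedPAdicLFunction_of_lattice [NeZero N] (hc : 0 < c) (hη : ηK.IsPrimitive)
    (hαK : αK ≠ 0) (hαn : ‖(ιp αK)⁻¹‖ ≤ (p : ℝ) ^ (1 / 2 : ℝ)) (hαp : ιp αK ≠ p) (hα : ι αK ≠ p)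
    (hΛ : Λ.FG) (hΨΛ : ∀ (M : ℕ) (a : ℕ), Ψ ((a : ℚ) / (p : ℚ) ^ M) ∈ Λ) :
    ∃ μ : (n : ℕ) → ZMod (p ^ n) → ℂ_[p], IsUntwistedPAdicLFunction p f (ηK.ringHomComp ιp) (ιp αK) μ := by
  classical
  -- instantiate the `K`-valued candidate by its defining formulas
  set SK' : (j : ℕ) → ZMod (p ^ j) → K := fun j y ↦ ∑ b : ZMod (p ^ c), ηK b *
    ((ratPlusSymbol f ((y.val : ℚ) / (p : ℚ) ^ j + (b.val : ℚ) / (p : ℚ) ^ c) : ℚ) : K) with hSK'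
  set νK' : (M : ℕ) → ZMod (p ^ M) → K := fun M x ↦
    (∑ i ∈ Finset.range M, αK⁻¹ ^ (i + 1) * ((p : K) ^ (i + 1) / (p : K) ^ M) *
        SK' (i + 1) ((x.val : ℕ) : ZMod (p ^ (i + 1)))) +
      ((p : K) ^ M)⁻¹ * (1 - αK / p)⁻¹ * SK' 0 0 with hνK'
  set ρK' : (M : ℕ) → ZMod (p ^ M) → K := fun M y ↦ ηK⁻¹ ((y.val : ℕ) : ZMod (p ^ c)) * νK' M y
    with hρK'
  set 𝓛K' : (n : ℕ) → ZMod (p ^ n) → K := fun n s ↦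
    ∑ᶠ T : rootsOfUnity (torsionOrder p) ℤ_[p],
      ∑ y ∈ Finset.univ.filter (fun y : ZMod (p ^ (c + cyclotomicExponent p + n)) ↦
        ZMod.castHom (pow_dvd_pow p (by omega : cyclotomicExponent p + n ≤ c + cyclotomicExponent p + n))
            (ZMod (p ^ (cyclotomicExponent p + n))) y =
          PadicInt.toZModPow (cyclotomicExponent p + n) ((T : ℤ_[p]ˣ) : ℤ_[p]) *
            (cyclotomicGenerator p : ZMod (p ^ (cyclotomicExponent p + n))) ^ s.val),
        ρK' (c + cyclotomicExponent p + n) y with h𝓛K'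
  have hα0 : ιp αK ≠ 0 := (map_ne_zero ιp).mpr hαK
  exact (exists_isUntwistedPAdicLFunction_iff_hasGrowthOrder_map_candidate ιp f ηK αK SK' (fun _ _ ↦ rfl)
    νK' (fun _ _ ↦ rfl) ρK' (fun _ _ ↦ rfl) 𝓛K' (fun _ _ ↦ rfl) hc hη hα0 hαp).mpr
    (hasGrowthOrder_half_map_candidate_of_lattice ιp ι f ηK αK SK' (fun _ _ ↦ rfl) νK' (fun _ _ ↦ rfl)
      ρK' (fun _ _ ↦ rfl) 𝓛K' (fun _ _ ↦ rfl) Ψ hΨper hΨrec hαK hαn hα hΛ hΨΛ)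

end Main

/-! ### §6 Curve level (`p = 3`, `c = 2`): the route's D1 predicate from a lattice -/

section Curve

variable {K : Type*} [Field K] (ιp : K →+* ℂ_[3]) (ι : K →+* ℂ)
variable {W : WeierstrassCurve ℚ} {N : ℕ} [NeZero N] {f : CuspForm (Gamma0 N) 2}
variable (ηK : DirichletCharacter K (3 ^ 2)) (αK : K)
variable (Ψ : ℚ → ℂ)
variable (hΨper : ∀ (r : ℚ) (n : ℤ), Ψ (r + n) = Ψ r)
variable (hΨrec : ∀ r : ℚ, Ψ r - ι αK / (3 : ℕ) * Ψ ((3 : ℕ) * r) =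
  ∑ b : ZMod (3 ^ 2), ι (ηK b) * ((ratPlusSymbol f (r + (b.val : ℚ) / ((3 : ℕ) : ℚ) ^ 2) : ℚ) : ℂ))
variable {Λ : Submodule ℤ ℂ}

include hΨper hΨrec in
/-- **The route's D1 predicate from a lattice (curve level).** For the newform `f` of `W` (`IsNewformOf W f`),
a coefficient field `K` with `ι_p : K →+* ℂ₃`, `ι_∞ : K →+* ℂ`, `η_K` primitive mod `9`, `α_K ≠ 0` with
`‖(ι_p α_K)⁻¹‖ ≤ √3`, `ι_p α_K ≠ 3`, `ι_∞ α_K ≠ 3`, and a `ℤ`-periodic complex untwist symbol `Ψ` with the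
`3`-deprivation identity whose values at the `a/3^M` lie in a finitely generated `ℤ`-submodule of `ℂ`:
`∃ 𝓛, IsPSCyclotomicLFunctionOf W (η_K ∘ ι_p) (ι_p α_K) 𝓛`. [cite: MazurTateTeitelbaum1986Invent, §I.14 (case p ∣ N, a_p ≠ 0)]
[cite: Bellaiche2021, Thm. 6.7.9] [cite: Manin1972, §1.5, Prop. 1.6] -/
theorem exists_isPSCyclotomicLFunctionOf_of_lattice (hf : IsNewformOf W f) (hη : ηK.IsPrimitive)
    (hαK : αK ≠ 0) (hαn : ‖(ιp αK)⁻¹‖ ≤ (3 : ℝ) ^ (1 / 2 : ℝ)) (hαp : ιp αK ≠ (3 : ℕ))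
    (hα : ι αK ≠ (3 : ℕ)) (hΛ : Λ.FG) (hΨΛ : ∀ (M : ℕ) (a : ℕ), Ψ ((a : ℚ) / ((3 : ℕ) : ℚ) ^ M) ∈ Λ) :
    ∃ 𝓛 : (n : ℕ) → ZMod (3 ^ n) → ℂ_[3], IsPSCyclotomicLFunctionOf W (ηK.ringHomComp ιp) (ιp αK) 𝓛 := by
  obtain ⟨μ, hμ⟩ := exists_isUntwistedPAdicLFunction_of_lattice (p := 3) ιp ι f ηK αK Ψ hΨper hΨrec
    (by norm_num) hη hαK (by exact_mod_cast hαn) hαp hα hΛ hΨΛ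
  exact ⟨μ, N, inferInstance, f, hf, hμ⟩

end Curve

end Summit.BirchSwinnertonDyer.BirchSwinnertonDyer.Theorems.PSF1OfLattice

end
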